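import Summits.AtomisticToContinuum.Crystallization.Theorems.FreeSplittingCertificatesStrictSplittingRuleP1ReadRegroup

/-!
# `StrictSplittingRule` (stmt-AtomisticToContinuum-12560): READOUT REGROUPING over an ARBITRARY per-cell ALLOCATION TABLE (P1 interpolant object, part 37)

Route `FreeSplittingCertificates`, crux r3 `StrictSplittingRule` (H12⋆ = `stub_coreJointCoercive`), unit b2b-freesplit-B gen 31.
VALUE = the bookkeeping step (R) of the demand side in the form the CERTIFIED far ledger actually uses (HOME CERT §28 (3)(B), §31; FAR-LEMMA-SPEC §19 (b)):
part 36 (`tsum_readout_inlayer_le`) booked every in-layer bond on ONE designated cell; the certificate (`cellval.py` / `celltail.py`, allocation rule v31)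
distributes the readout of a bond `e = (q, q+s)` over SEVERAL carrier cells `T ∋ e` with nonnegative shares `θ(e, T)`, `Σ_T θ(e, T) = 1` (the shed set = rows
with zero bond weight).  For any such table:
* **`tsum_le_tsum_regroup`** (abstract): `A e ≤ Σᶠ_T F e T` with `F ≥ 0` of finite support in each variable and `Σ'_T Σᶠ_e F e T` summable
  ⇒ `Σ'_e A e ≤ Σ'_T Σᶠ_e F e T` (double series of nonnegative terms, `summable_prod_of_nonneg` + `tsum_comm'`);
* **`tsum_readout_leg_table_le`**: for nonnegative bond weights `w`, lattice values `V` and a share table `θ` supported on carrier cells (cells having the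
  bond as an edge), `Σ'_{(q,s)} w(q,s)|V(q+s) − V(q)|² ≤ Σ'_T [Σᶠ_{(q,s)} θ((q,s),T)·w(q,s)·|y_{q+s} − y_q|²]·|G_T|²_F` — the cell-indexed CAPACITY form with the
  table's per-cell load coefficient, provided that family is summable.
NOT a proof of H12⋆, NOT summit progress.  [folklore]
-/

noncomputable section

open Set Function
open scoped BigOperators

namespace Summit.AtomisticToContinuum.Crystallization.Theorems.StrictSplittingRuleBirth

open Literature.MathematicalPhysics.StatisticalMechanics
open Summit.AtomisticToContinuum.Crystallization.Theorems.PalmUnimodularRigidity.LayeredLawsSelectHcp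

/-! ## Abstract regrouping of a nonnegative double family with finite sections -/

/-- **Regrouping lemma**: if `0 ≤ A e ≤ Σᶠ_T F e T` with `F ≥ 0`, every `F e ·` and every `F · T` finitely supported, and the cell family
`T ↦ Σᶠ_e F e T` summable, then `A` is summable and `Σ'_e A e ≤ Σ'_T Σᶠ_e F e T`.  NOT a proof of H12⋆, NOT summit progress. -/
theorem tsum_le_tsum_regroup {E C : Type*} (A : E → ℝ) (F : E → C → ℝ) (hA : ∀ e, 0 ≤ A e) (hF : ∀ e T, 0 ≤ F e T)
    (hfinE : ∀ e, (Function.support (F e)).Finite) (hfinC : ∀ T, (Function.support fun e => F e T).Finite)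
    (hle : ∀ e, A e ≤ ∑ᶠ T, F e T) (hs : Summable fun T => ∑ᶠ e, F e T) :
    Summable A ∧ ∑' e, A e ≤ ∑' T, ∑ᶠ e, F e T := by
  -- finite sections: summable, tsum = finsum
  have hrowF : ∀ T, Summable fun e => F e T := fun T => summable_of_hasFiniteSupport (hfinC T)
  have hrow_eq : ∀ T, ∑' e, F e T = ∑ᶠ e, F e T := fun T => tsum_eq_finsum (hfinC T)
  have hcol : ∀ e, Summable (F e) := fun e => summable_of_hasFiniteSupport (hfinE e)
  have hcol_eq : ∀ e, ∑' T, F e T = ∑ᶠ T, F e T := fun e => tsum_eq_finsum (hfinE e)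
  -- the swapped double family G (T, e) = F e T is summable on C × E (nonnegative: rows summable + row sums summable)
  have hGs : Summable (fun p : C × E => F p.2 p.1) := by
    refine (summable_prod_of_nonneg fun p => hF _ _).2 ⟨hrowF, ?_⟩
    exact hs.congr fun T => (hrow_eq T).symm
  -- hence F (uncurried) is summable on E × C, and so is its E-marginal
  have hFs : Summable (Function.uncurry F) := by
    have : Function.uncurry F = (fun p : C × E => F p.2 p.1) ∘ (Equiv.prodComm E C) := by
      funext p; rfl
    rw [this]; exact (Equiv.summable_iff _).2 hGs
  have hmargE : Summable fun e => ∑' T, F e T := hFs.prod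
  have hmargE' : Summable fun e => ∑ᶠ T, F e T := hmargE.congr fun e => hcol_eq e
  have hsA : Summable A := Summable.of_nonneg_of_le hA hle hmargE'
  refine ⟨hsA, ?_⟩
  calc ∑' e, A e ≤ ∑' e, ∑ᶠ T, F e T := Summable.tsum_le_tsum hle hsA hmargE'
    _ = ∑' e, ∑' T, F e T := tsum_congr fun e => (hcol_eq e).symm
    _ = ∑' T, ∑' e, F e T := (hFs.tsum_comm' hcol hrowF).symm
    _ = ∑' T, ∑ᶠ e, F e T := tsum_congr fun T => hrow_eq T

/-! ## The readout of arbitrary legs over a share table -/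

/-- **THE READOUT REGROUPING OVER AN ALLOCATION TABLE**: legs `e = (q, s)` (from `q` to `q + s`, ANY lattice vector `s` — the in-layer stencil bonds
and the slanted legs `(q,b)`, `(b,q+(2,0,0))` of the vertical route alike), nonnegative leg weights `w e`, a nonnegative share table `θ e T` with finite
support in each variable, unit row sums, and the CARRIER property (a cell with a nonzero share has both leg ends among its vertices).  Then
`Σ'_e w e·|V(q + s) − V(q)|² ≤ Σ'_T (Σᶠ_e θ e T·w e·|y_{q+s} − y_q|²)·|G_T|²_F`, provided the right-hand (cell-indexed capacity) family is summable.
NOT a proof of H12⋆, NOT summit progress. -/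
theorem tsum_readout_leg_table_le {a h : ℝ} (ha : a ≠ 0) (hh : h ≠ 0) (V : ℤ × ℤ × ℤ → (Fin 3 → ℝ))
    (w : (ℤ × ℤ × ℤ) × (ℤ × ℤ × ℤ) → ℝ) (hw : ∀ e, 0 ≤ w e)
    (θ : (ℤ × ℤ × ℤ) × (ℤ × ℤ × ℤ) → (ℤ × ℤ × ℤ) × Fin 6 → ℝ) (hθ : ∀ e T, 0 ≤ θ e T)
    (hfinE : ∀ e, (Function.support (θ e)).Finite) (hfinC : ∀ T, (Function.support fun e => θ e T).Finite)
    (hsum : ∀ e, ∑ᶠ T, θ e T = 1)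
    (hcar : ∀ e T, θ e T ≠ 0 → ∃ m m' : Fin 4, e.1 = T.1 + p1VertOff (p1Par T.1) T.2 m ∧
      e.1 + e.2 = T.1 + p1VertOff (p1Par T.1) T.2 m')
    (hs : Summable fun T : (ℤ × ℤ × ℤ) × Fin 6 =>
      (∑ᶠ e, θ e T * w e * fpSq (fun k => hcpSite a h (e.1 + e.2) k - hcpSite a h e.1 k)) * fpFrob (p1CellGrad a h V T)) :
    Summable (fun e : (ℤ × ℤ × ℤ) × (ℤ × ℤ × ℤ) => w e * fpSq (fun k => V (e.1 + e.2) k - V e.1 k)) ∧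
    ∑' e : (ℤ × ℤ × ℤ) × (ℤ × ℤ × ℤ), w e * fpSq (fun k => V (e.1 + e.2) k - V e.1 k) ≤
    ∑' T : (ℤ × ℤ × ℤ) × Fin 6,
      (∑ᶠ e, θ e T * w e * fpSq (fun k => hcpSite a h (e.1 + e.2) k - hcpSite a h e.1 k)) * fpFrob (p1CellGrad a h V T) := by
  set F : (ℤ × ℤ × ℤ) × (ℤ × ℤ × ℤ) → (ℤ × ℤ × ℤ) × Fin 6 → ℝ := fun e T =>
    θ e T * w e * fpSq (fun k => hcpSite a h (e.1 + e.2) k - hcpSite a h e.1 k) * fpFrob (p1CellGrad a h V T) with hFdef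
  have hF0 : ∀ i, 0 ≤ fpFrob (p1CellGrad a h V i) := fun i => by unfold fpFrob; positivity
  have hS0 : ∀ f : Fin 3 → ℝ, 0 ≤ fpSq f := fun f => by unfold fpSq; positivity
  have hFnn : ∀ e T, 0 ≤ F e T := fun e T => mul_nonneg (mul_nonneg (mul_nonneg (hθ e T) (hw e)) (hS0 _)) (hF0 _)
  -- supports of F are inside the supports of θ
  have hsuppE : ∀ e, Function.support (F e) ⊆ Function.support (θ e) := by
    intro e T hT
    simp only [Function.mem_support, ne_eq] at hT ⊢
    intro h0; apply hT; simp only [hFdef, h0, zero_mul]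
  have hsuppC : ∀ T, (Function.support fun e => F e T) ⊆ Function.support fun e => θ e T := by
    intro T e he
    simp only [Function.mem_support, ne_eq] at he ⊢
    intro h0; apply he; simp only [hFdef, h0, zero_mul]
  have hfinFE : ∀ e, (Function.support (F e)).Finite := fun e => (hfinE e).subset (hsuppE e)
  have hfinFC : ∀ T, (Function.support fun e => F e T).Finite := fun T => (hfinC T).subset (hsuppC T)
  -- the cell family: Σᶠ_e F e T = (Σᶠ_e θ w ℓ²) · |G_T|²
  have hcell : ∀ T, ∑ᶠ e, F e T =
      (∑ᶠ e, θ e T * w e * fpSq (fun k => hcpSite a h (e.1 + e.2) k - hcpSite a h e.1 k)) * fpFrob (p1CellGrad a h V T) := by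
    intro T
    rw [← finsum_mul' _ _ (hfinC T |>.subset ?_)]
    · intro e he
      simp only [Function.mem_support, ne_eq] at he ⊢
      intro h0; apply he; simp only [h0, zero_mul]
  -- termwise: A e ≤ Σᶠ_T F e T, by the carrier property and the unit row sum
  have hle : ∀ e, w e * fpSq (fun k => V (e.1 + e.2) k - V e.1 k) ≤ ∑ᶠ T, F e T := by
    intro e
    have hbd : ∀ T, θ e T * (w e * fpSq (fun k => V (e.1 + e.2) k - V e.1 k)) ≤ F e T := by
      intro T
      by_cases h0 : θ e T = 0
      · simp only [hFdef, h0, zero_mul, le_refl]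
      · obtain ⟨m, m', hm, hm'⟩ := hcar e T h0
        have hb := p1_bond_readout_le ha hh V T m m' hm hm'
        have := mul_le_mul_of_nonneg_left (mul_le_mul_of_nonneg_left hb (hw e)) (hθ e T)
        simp only [hFdef]
        calc θ e T * (w e * fpSq (fun k => V (e.1 + e.2) k - V e.1 k))
            ≤ θ e T * (w e * (fpSq (fun k => hcpSite a h (e.1 + e.2) k - hcpSite a h e.1 k) * fpFrob (p1CellGrad a h V T))) := this
          _ = θ e T * w e * fpSq (fun k => hcpSite a h (e.1 + e.2) k - hcpSite a h e.1 k) * fpFrob (p1CellGrad a h V T) := by ring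
    calc w e * fpSq (fun k => V (e.1 + e.2) k - V e.1 k)
        = (∑ᶠ T, θ e T) * (w e * fpSq (fun k => V (e.1 + e.2) k - V e.1 k)) := by rw [hsum e, one_mul]
      _ = ∑ᶠ T, θ e T * (w e * fpSq (fun k => V (e.1 + e.2) k - V e.1 k)) := finsum_mul' _ _ (hfinE e)
      _ ≤ ∑ᶠ T, F e T := finsum_le_finsum' ((hfinE e).subset fun T hT => by
            simp only [Function.mem_support, ne_eq] at hT ⊢; intro h0; apply hT; simp only [h0, zero_mul]) (hfinFE e) fun T => hbd T
  have hA0 : ∀ e : (ℤ × ℤ × ℤ) × (ℤ × ℤ × ℤ), 0 ≤ w e * fpSq (fun k => V (e.1 + e.2) k - V e.1 k) := fun e => mul_nonneg (hw e) (hS0 _)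
  have hs' : Summable fun T => ∑ᶠ e, F e T := by simpa only [hcell] using hs
  obtain ⟨hsA, hineq⟩ := tsum_le_tsum_regroup _ F hA0 hFnn hfinFE hfinFC hle hs'
  refine ⟨hsA, ?_⟩
  simpa only [hcell] using hineq

end Summit.AtomisticToContinuum.Crystallization.Theorems.StrictSplittingRuleBirth

end
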